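import Summits.BirchSwinnertonDyer.BirchSwinnertonDyer.Theorems.SignedLowerHalvesSprungLowerHalfAtThreeChromaticReduction
import Literature.NumberTheory.EllipticCurves.Sprung2012.SharpFlatSelmerDualExistsProofs
import Literature.NumberTheory.EllipticCurves.Sprung2012.ColemanMapTheorems
import Literature.NumberTheory.EllipticCurves.Sprung2024.ChromaticCharValueRankZero
import HarnessLib

/-!
# Route `SignedLowerHalves`, crux `SprungLowerHalfAtThree` (item stmt-BirchSwinnertonDyer-19003), stub (B)
# `stub_chromaticDivisibility`: the glued split INSTANTIATED on Sprung's REAL chromatic Selmer dual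
# `X^•(E/ℚ_∞)` — (B) on X8 ∩ {N square-free} ⟸ (conv₀) ∧ (MC↓•) for `Sprung2012.SharpFlatSelmerDualData`,
# with (K•) = Sprung 2024 §5.2 BY NAME (cell `bsd-ssimc`, seat `bsd-ssimc-k3c5-kdot-split` g2; a
# `--supports … --as helper` file, closes nothing)

PARTITION (cell bsd-ssimc): X8 (A8) — `p = 3` good supersingular, `a_3 = ±3` — ∩ {`N` square-free},
crux 5's clause (B) at every analytic rank; types-the-object-of; closes NONE; nothing is booked; BSD
is not proved by any of this.

## What this file proves

The predecessor file `…KDotSplit.lean` (p455213/p458038) proved the glued split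
«(B) ⇐ (K•)(Dual) ∧ (MC↓•)(Dual)» over an ABSTRACT chromatic Selmer-dual theory displayed as
binders `Dual`, `charIdeal`, `hne`, `hK`, `hdiv`, because Sprung's `X^{♯/♭}(E/ℚ_∞)` was not tree
vocabulary (ledger item `defn-SharpFlatSelmerDualData` BLOCKED `decl-missing:SharpFlatLocalCondition`).
It now is: `Literature/…/Sprung2012/ColemanMaps.lean` + `SharpFlatSelmer.lean` type Sprung's
pairings `P_{n,x}`, Honda systems, the Coleman characterisation `IsColemanPair`, `Ker Col^•`, the
local condition `E^•_{∞,𝔭}` (Def. 7.9) and `Sel^•(E/K_∞)`, `X^•(E/K_∞)` (Def. 7.11) on the dual side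
`H¹_Iw(T) ≅ Hom(E(K_{∞,𝔭}), ℤ_p)` (supersingular `p`; Sprung 2012 Lemma 7.10), the datum EXISTS
(`Sprung2012.nonempty_sharpFlatSelmerDualData`, a construction), and (K•) is the named fact
`Sprung2024.lem59_sharpFlatCharValue_rankZero` (Sprung, Adv. Math. 449 (2024) §5.2 Lemmas 5.5·5.8·5.9,
REFEREED, unconditional — Conj. 3.33 is not used by those lemmas) with the cotorsion input
`Sprung2024.sec52_sharpFlatSelmerDual_finite_torsion` (§5.2 p. 39 ⇐ Sprung 2012 Thm. 7.14). So here
the binders `Dual`/`charIdeal`/`hne`/`hK` are DISCHARGED and exactly TWO displayed inputs remain: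

* (MC↓•) `hdiv` — **Sprung 2012 Main Conjecture 7.21 (`η = 1`), Eisenstein half, Néron-normalised,
  for ONE colour, on the real `X^•(E/ℚ_∞)`**: on X8, in the cyclotomic setting, for every Honda system
  and the real objects `(f, ϖ, L♯, L♭)` of stub (A), some colour `•` has `char X^• = (g)` with
  `ι g = ϖ·ι(L^•·h)` for every dual datum — the OPEN crux content (Sprung 2024 Thm. 1.1 ⇐ Conj. 3.33;
  CCSS arXiv:1804.10993 / Fouquet–Wan arXiv:2107.13726 PRE); this is the `ChromaticLowerDivisibility`
  of the planner's ACCEL row, now a statement about REAL objects;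
* (conv₀) `hconv` — the rank-`0` `3`-converse on X8, `Sel_{3^∞}(E/ℚ)` finite ⇒ `L(E,1) ≠ 0` (OPEN
  at `(3, ±3)`; needed because the printed (K•) is stated under `L(E,1) ≠ 0`, and necessary anyway:
  (B) ⟺ (conv₀) ∧ (low₀) at corank `0`, p417882) — or, in the second theorem, the inserted hypothesis
  `W.analyticRank = 0` with modularity `hasEntireLFunction_rat` by name;
plus two small EXISTENCE inputs displayed honestly: `h22 : Sprung2012.thm22_exists_isHondaSystem`
(Sprung 2012 Thm. 2.2, named fact) and `hlift` — a local Galois element at `p` restricting to the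
chosen topological generator (folklore: `p` is totally ramified in `ℚ_∞`; not yet a tree lemma).
The printed (K•) carries square-free `N` (§5.2's standing hypothesis), hence the inserted hypothesis
`W.IsSemistable (𝓞 ℚ)`: on board A8 this is 28 of the 142 rank-`0` cells verbatim.

* `chromaticDivisibility_of_sharpFlatLowerDivisibility` — the conclusion of stub (B) for one X8 pair
  with square-free `N`, given `Finite Sel_{3^∞}(E/ℚ) → L(E,1) ≠ 0` for that pair: if `Sel_{3^∞}` is
  infinite, `ξ = h = 0` (`chromaticDatum_of_not_finite_selmer`); else `ξ :=` the generator of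
  `char X^•` delivered by (MC↓•) for the datum `Sprung2012.sharpFlatSelmerDualData …`, whose Euler
  characteristic is (K•) by name.
* `stub_chromaticDivisibility_of_sharpFlatLowerDivisibility_semistable` — the registered stub header
  VERBATIM with `W.IsSemistable (𝓞 ℚ)` inserted, from (conv₀) ∧ (MC↓•) (+ `h22`, `hlift`, the two
  Sprung 2024 facts).
* `stub_chromaticDivisibility_of_sharpFlatLowerDivisibility_rankZero` — the same with
  `W.analyticRank = 0` inserted instead of (conv₀) (modularity `hasEntireLFunction_rat` by name).

HONEST STATUS: CONDITIONAL theorems (named-fact hypotheses `h22`, `h52`, `hK`, `hmod`; displayed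
`hlift`, `hconv`, `hdiv`); (MC↓•) is OPEN mathematics; nothing here narrows any class; 0 cells move.
What changed versus p455213: the ♯/♭ objects and (K•) are now BY NAME (typed ≠ proved ≠ endorsed).

References: [Sprung2012] Thm. 2.2, Def. 3.1, Def. 5.9/7.1, Def. 7.9/7.11, Lemma 7.10, Thm. 7.14,
Main Conj. 7.21; [Sprung2024] §5.2 (p. 39, Remark 5.4, Lemmas 5.5–5.9, p. 41); [Kobayashi2003]
Def. 1.1; [GreenbergLNM1716] §1, Lemma 4.2; [Miller2011LMS] Def. 1.1.
-/

set_option autoImplicit false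
set_option linter.dupNamespace false

noncomputable section

open scoped Classical MatrixGroups ModularForm NumberField

open CongruenceSubgroup WeierstrassCurve NumberField IsDedekindDomain
  Literature.NumberTheory.EllipticCurves Literature.NumberTheory.EllipticCurves.ModularForms
  Literature.NumberTheory.EllipticCurves.Rank1Residual
  Literature.NumberTheory.EllipticCurves.Rank1Residual.Typed
  Literature.NumberTheory.EllipticCurves.Sprung2017 Literature.NumberTheory.EllipticCurves.Sprung2012
  Literature.NumberTheory.EllipticCurves.ZpExtension
  Summit.BirchSwinnertonDyer.Rank1Residual.Supersingular

namespace Summit.BirchSwinnertonDyer.BirchSwinnertonDyer.Theorems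

/-- Every rational prime `p` lies in some nonzero prime `v` of `𝓞 ℚ` (going up along `ℤ → 𝓞 ℚ`;
used to name the place of `ℚ` above `p` carrying the local ♯/♭ data). [folklore] -/
private theorem exists_heightOneSpectrum_natCast_mem_rat (p : ℕ) (hp : p.Prime) :
    ∃ v : HeightOneSpectrum (𝓞 ℚ), (p : 𝓞 ℚ) ∈ v.asIdeal := by
  haveI hmax : (Ideal.span {(p : ℤ)}).IsMaximal :=
    PrincipalIdealRing.isMaximal_of_irreducible (Nat.prime_iff_prime_int.mp hp).irreducible
  obtain ⟨Q, hQmax, hQ⟩ := Ideal.exists_ideal_over_maximal_of_isIntegral (S := 𝓞 ℚ)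
    (Ideal.span {(p : ℤ)}) (by
      rw [(RingHom.injective_iff_ker_eq_bot _).mp (algebraMap ℤ (𝓞 ℚ)).injective_int]
      exact bot_le)
  have hpQ : (p : 𝓞 ℚ) ∈ Q := by
    have : (p : ℤ) ∈ Q.comap (algebraMap ℤ (𝓞 ℚ)) := by
      rw [hQ]; exact Ideal.mem_span_singleton_self _
    simpa [Ideal.mem_comap] using this
  have hQne : Q ≠ ⊥ := by
    intro hbot
    rw [hbot, Ideal.mem_bot] at hpQ
    exact hp.ne_zero (by exact_mod_cast hpQ)
  exact ⟨⟨Q, hQmax.isPrime, hQne⟩, hpQ⟩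

section Real

/-- **(B) for one X8 pair with square-free conductor, on Sprung's REAL `X^•(E/ℚ_∞)`.** Inputs BY
NAME: `h22` (Sprung 2012 Thm. 2.2: a Honda system exists), `h52` (Sprung 2024 §5.2 / Sprung 2012
Thm. 7.14: `X^•` finitely generated torsion when `L(E,1) ≠ 0`), `hK` ((K•) = Sprung 2024 Lemmas
5.5·5.8·5.9). Displayed: `hlift` (a local Galois element at `p` restricting to the generator `γ`;
folklore), `hdiv` ((MC↓•): Sprung 2012 Main Conj. 7.21's Eisenstein half for ONE colour on the real
dual data — OPEN), and for THIS pair `hconv : Finite Sel_{p^∞}(E/ℚ) → L(E,1) ≠ 0`. Conclusion: the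
body of `stub_chromaticDivisibility` for the given real objects `(f, ϖ, L♯, L♭)`. Proof: if
`Sel_{3^∞}(E/ℚ)` is infinite, `ξ = h = 0`; otherwise `ξ :=` the generator `g` of `char X^•` given by
(MC↓•) for the datum `Sprung2012.sharpFlatSelmerDualData …`, and (K•) by name gives Kim's
Euler-characteristic property of `⟨g, 0, 0⟩`. CONDITIONAL; closes nothing.
[cite: Sprung2012, Def. 7.11 and Main Conj. 7.21 (shape of `hdiv`)] [cite: Sprung2024, §5.2 Lemmas 5.5–5.9 (via `hK`)] -/
theorem chromaticDivisibility_of_sharpFlatLowerDivisibility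
    (h22 : Sprung2012.thm22_exists_isHondaSystem)
    (h52 : Sprung2024.sec52_sharpFlatSelmerDual_finite_torsion)
    (hK : Sprung2024.lem59_sharpFlatCharValue_rankZero)
    (hlift : ∀ (p : ℕ) [Fact p.Prime] (κ : ZpExtension ℚ p) (γ : Field.absoluteGaloisGroup ℚ),
      κ.IsCyclotomic → κ.IsTopGenerator γ →
      ∀ (v : HeightOneSpectrum (𝓞 ℚ)), (p : 𝓞 ℚ) ∈ v.asIdeal →
        ∃ g : Field.absoluteGaloisGroup (v.adicCompletion ℚ),
          κ.IsTopGenerator (resGalOfEmb (closureEmb (K := ℚ) (v.adicCompletion ℚ)) g))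
    (hdiv : ∀ (W : WeierstrassCurve ℚ) [W.IsElliptic] [W.IsGloballyMinimal] (p : ℕ) [Fact p.Prime],
      ClassX8 W p → ∀ (κ : ZpExtension ℚ p) (γ : Field.absoluteGaloisGroup ℚ),
        κ.IsCyclotomic → κ.IsTopGenerator γ → IsCyclotomicVariable p γ →
      ∀ (v : HeightOneSpectrum (𝓞 ℚ)), (p : 𝓞 ℚ) ∈ v.asIdeal →
      ∀ (g : Field.absoluteGaloisGroup (v.adicCompletion ℚ)),
        κ.IsTopGenerator (resGalOfEmb (closureEmb (K := ℚ) (v.adicCompletion ℚ)) g) →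
      ∀ (cneg : localPoints W (v.adicCompletion ℚ)) (c : ℕ → localPoints W (v.adicCompletion ℚ)),
        IsHondaSystem κ (closureEmb (K := ℚ) (v.adicCompletion ℚ)) W (W.frobeniusTrace p) g cneg c →
      ∀ (N : ℕ) (_ : NeZero N) (f : CuspForm (Gamma0 N) 2) (ϖ : ℚ) (Lsharp Lflat : IwasawaAlgebra p),
        IsNewformOf W f → (ϖ : ℝ) * W.realPeriodRat = plusPeriod f →
        IsSprungPair f p (W.frobeniusTrace p) Lsharp Lflat →
        ∃ col : Chroma,
          ∀ D : SharpFlatSelmerDualData W κ γ (closureEmb (K := ℚ) (v.adicCompletion ℚ))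
            (W.frobeniusTrace p) g c col,
          ∃ gen h : IwasawaAlgebra p, D.charIdeal = Ideal.span {gen} ∧
            iwasawaToPowerSeries p gen =
              PowerSeries.C (ϖ : ℚ_[p]) * iwasawaToPowerSeries p (chromaticL col Lsharp Lflat * h))
    (W : WeierstrassCurve ℚ) [W.IsElliptic] [W.IsGloballyMinimal] (p : ℕ) [Fact p.Prime]
    (hX : ClassX8 W p) (hsst : W.IsSemistable (𝓞 ℚ))
    (hconv : Finite (W.selmerGroupPInfty p) → W.entireLFunction 1 ≠ 0)
    (N : ℕ) (hN : NeZero N) (f : CuspForm (Gamma0 N) 2) (ϖ : ℚ) (Lsharp Lflat : IwasawaAlgebra p)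
    (hf : IsNewformOf W f) (hϖ : (ϖ : ℝ) * W.realPeriodRat = plusPeriod f)
    (hSP : IsSprungPair f p (W.frobeniusTrace p) Lsharp Lflat) :
    ∃ (col : Chroma) (ξ : IwasawaAlgebra p), (⟨ξ, 0, 0⟩ : SignedDatum W p).EulerCharacteristic ∧
      ∃ h : IwasawaAlgebra p, iwasawaToPowerSeries p ξ =
        PowerSeries.C (ϖ : ℚ_[p]) * iwasawaToPowerSeries p (chromaticL col Lsharp Lflat * h) := by
  by_cases hfin : Finite (W.selmerGroupPInfty p)
  swap
  · exact ⟨.flat, chromaticDatum_of_not_finite_selmer W p hfin ϖ (chromaticL .flat Lsharp Lflat)⟩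
  have hp3 : p = 3 := hX.1
  subst hp3
  have hp2 : (3 : ℕ) ≠ 2 := by decide
  have hgood : W.HasGoodReductionAtPrime 3 := hX.2.1.1
  have hdvd : ((3 : ℕ) : ℤ) ∣ W.frobeniusTrace 3 := hX.2.1.2
  have hL : W.entireLFunction 1 ≠ 0 := hconv hfin
  -- the cyclotomic setting, the place above `3`, a local lift of `γ`, a Honda system
  obtain ⟨κ, hκ, γ, hγ, hγ'⟩ := exists_isCyclotomic_isTopGenerator_isCyclotomicVariable_holds 3
  obtain ⟨v, hv⟩ := exists_heightOneSpectrum_natCast_mem_rat 3 (by norm_num)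
  obtain ⟨g, hg⟩ := hlift 3 κ γ hκ hγ v hv
  obtain ⟨cneg, c, hc⟩ := h22 W 3 hp2 hgood hdvd κ γ hκ hγ hγ' v hv g hg
  -- (MC↓•): a colour, and for every dual datum a generator with the Néron-normalised divisibility
  obtain ⟨col, hcol⟩ := hdiv W 3 hX κ γ hκ hγ hγ' v hv g hg cneg c hc N hN f ϖ Lsharp Lflat hf hϖ hSP
  -- Sprung's real `X^•(E/ℚ_∞)` (the construction) and its generator
  obtain ⟨gen, h, hchar, hι⟩ :=
    hcol (sharpFlatSelmerDualData W κ (closureEmb (K := ℚ) (v.adicCompletion ℚ))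
      (W.frobeniusTrace 3) g c col hγ)
  -- cotorsion (Sprung 2024 §5.2 / Sprung 2012 Thm. 7.14) and (K•) by name
  obtain ⟨hfinD, htorD⟩ := h52 W 3 hp2 hsst hgood hdvd hL κ γ hκ hγ hγ' v hv g hg cneg c hc col
    (sharpFlatSelmerDualData W κ (closureEmb (K := ℚ) (v.adicCompletion ℚ)) (W.frobeniusTrace 3) g c
      col hγ)
  haveI := hfinD
  obtain ⟨u, hu⟩ := hK W 3 hp2 hsst hgood hdvd hL κ γ hκ hγ hγ' v hv g hg cneg c hc col _ htorD gen
    hchar hfin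
  exact ⟨col, gen, fun _ => ⟨u, hu⟩, h, hι⟩

/-- **The registered stub (B) VERBATIM on X8 ∩ {`N` square-free}, from (conv₀) ∧ (MC↓•) on Sprung's
REAL `X^•(E/ℚ_∞)`, with (K•) and the cotorsion BY NAME** (`hK`, `h52`: Sprung 2024 §5.2; `h22`:
Sprung 2012 Thm. 2.2; `hlift` displayed). The header of `stub_chromaticDivisibility` (skeleton
`Cruxes/SprungLowerHalfAtThree/Lines/birth.lean`) with the single extra hypothesis
`W.IsSemistable (𝓞 ℚ)` (the printed scope of (K•)). `hconv` = (conv₀) on X8 (OPEN); `hdiv` = (MC↓•)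
(OPEN). This is the instantiation of p455213's `stub_chromaticDivisibility_of_split` with
`Dual := Sprung2012.SharpFlatSelmerDualData`: the r0 residue of X8 ∩ {square-free} for crux 5's
clause (B) now reads «(conv₀) ∧ Sprung's Main Conj. 7.21 Eisenstein half for one colour», all ♯/♭
objects by name. CONDITIONAL; closes nothing; 0 cells move.
[cite: Sprung2012, Def. 7.11 and Main Conj. 7.21 (shape of `hdiv`)] [cite: Sprung2024, §5.2 Lemmas 5.5–5.9 (via `hK`)] -/
theorem stub_chromaticDivisibility_of_sharpFlatLowerDivisibility_semistable
    (h22 : Sprung2012.thm22_exists_isHondaSystem)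
    (h52 : Sprung2024.sec52_sharpFlatSelmerDual_finite_torsion)
    (hK : Sprung2024.lem59_sharpFlatCharValue_rankZero)
    (hlift : ∀ (p : ℕ) [Fact p.Prime] (κ : ZpExtension ℚ p) (γ : Field.absoluteGaloisGroup ℚ),
      κ.IsCyclotomic → κ.IsTopGenerator γ →
      ∀ (v : HeightOneSpectrum (𝓞 ℚ)), (p : 𝓞 ℚ) ∈ v.asIdeal →
        ∃ g : Field.absoluteGaloisGroup (v.adicCompletion ℚ),
          κ.IsTopGenerator (resGalOfEmb (closureEmb (K := ℚ) (v.adicCompletion ℚ)) g))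
    (hconv : ∀ (W : WeierstrassCurve ℚ) [W.IsElliptic] [W.IsGloballyMinimal] (p : ℕ) [Fact p.Prime],
      ClassX8 W p → Finite (W.selmerGroupPInfty p) → W.entireLFunction 1 ≠ 0)
    (hdiv : ∀ (W : WeierstrassCurve ℚ) [W.IsElliptic] [W.IsGloballyMinimal] (p : ℕ) [Fact p.Prime],
      ClassX8 W p → ∀ (κ : ZpExtension ℚ p) (γ : Field.absoluteGaloisGroup ℚ),
        κ.IsCyclotomic → κ.IsTopGenerator γ → IsCyclotomicVariable p γ →
      ∀ (v : HeightOneSpectrum (𝓞 ℚ)), (p : 𝓞 ℚ) ∈ v.asIdeal →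
      ∀ (g : Field.absoluteGaloisGroup (v.adicCompletion ℚ)),
        κ.IsTopGenerator (resGalOfEmb (closureEmb (K := ℚ) (v.adicCompletion ℚ)) g) →
      ∀ (cneg : localPoints W (v.adicCompletion ℚ)) (c : ℕ → localPoints W (v.adicCompletion ℚ)),
        IsHondaSystem κ (closureEmb (K := ℚ) (v.adicCompletion ℚ)) W (W.frobeniusTrace p) g cneg c →
      ∀ (N : ℕ) (_ : NeZero N) (f : CuspForm (Gamma0 N) 2) (ϖ : ℚ) (Lsharp Lflat : IwasawaAlgebra p),
        IsNewformOf W f → (ϖ : ℝ) * W.realPeriodRat = plusPeriod f →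
        IsSprungPair f p (W.frobeniusTrace p) Lsharp Lflat →
        ∃ col : Chroma,
          ∀ D : SharpFlatSelmerDualData W κ γ (closureEmb (K := ℚ) (v.adicCompletion ℚ))
            (W.frobeniusTrace p) g c col,
          ∃ gen h : IwasawaAlgebra p, D.charIdeal = Ideal.span {gen} ∧
            iwasawaToPowerSeries p gen =
              PowerSeries.C (ϖ : ℚ_[p]) * iwasawaToPowerSeries p (chromaticL col Lsharp Lflat * h)) :
    ∀ (W : WeierstrassCurve ℚ) [W.IsElliptic] [W.IsGloballyMinimal] (p : ℕ) [Fact p.Prime],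
      Literature.NumberTheory.EllipticCurves.Rank1Residual.ClassX8 W p → W.IsSemistable (𝓞 ℚ) →
      ∀ (N : ℕ) (_ : NeZero N) (f : CuspForm (CongruenceSubgroup.Gamma0 N) 2) (ϖ : ℚ)
        (Lsharp Lflat : Literature.NumberTheory.EllipticCurves.IwasawaAlgebra p),
        Literature.NumberTheory.EllipticCurves.ModularForms.IsNewformOf W f →
        (ϖ : ℝ) * W.realPeriodRat = Literature.NumberTheory.EllipticCurves.ModularForms.plusPeriod f →
        Literature.NumberTheory.EllipticCurves.Sprung2017.IsSprungPair f p (W.frobeniusTrace p)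
          Lsharp Lflat →
        ∃ (c : Literature.NumberTheory.EllipticCurves.Sprung2017.Chroma)
          (ξ : Literature.NumberTheory.EllipticCurves.IwasawaAlgebra p),
          (⟨ξ, 0, 0⟩ : Summit.BirchSwinnertonDyer.Rank1Residual.Supersingular.SignedDatum W p).EulerCharacteristic ∧
          ∃ h : Literature.NumberTheory.EllipticCurves.IwasawaAlgebra p,
            Literature.NumberTheory.EllipticCurves.iwasawaToPowerSeries p ξ =
              PowerSeries.C (ϖ : ℚ_[p]) *
                Literature.NumberTheory.EllipticCurves.iwasawaToPowerSeries p
                  (Literature.NumberTheory.EllipticCurves.Sprung2017.chromaticL c Lsharp Lflat * h) := by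
  intro W _ _ p _ hX hsst N hN f ϖ Lsharp Lflat hf hϖ hSP
  exact chromaticDivisibility_of_sharpFlatLowerDivisibility h22 h52 hK hlift hdiv W p hX hsst
    (hconv W p hX) N hN f ϖ Lsharp Lflat hf hϖ hSP

/-- **The registered stub (B) VERBATIM on X8 ∩ {`N` square-free} ∩ {`r_an = 0`}, from (MC↓•) on
Sprung's REAL `X^•(E/ℚ_∞)` alone** (plus the named facts `h22`, `h52`, `hK`, modularity
`hmod : hasEntireLFunction_rat` for `r_an = 0 ⇒ L(E,1) ≠ 0`, and `hlift` displayed): at analytic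
rank `0` the (conv₀) input is not needed. Together with p455213's
`stub_chromaticDivisibility_of_analyticRank_eq_one` (r_an `= 1`, GZK) this covers X8 ∩ {square-free}
∩ {r_an ≤ 1}: clause (B) there reads «Sprung's Main Conj. 7.21 Eisenstein half for one colour» BY
NAME. CONDITIONAL; closes nothing; 0 cells move.
[cite: Sprung2012, Def. 7.11 and Main Conj. 7.21 (shape of `hdiv`)] [cite: Sprung2024, §5.2 Lemmas 5.5–5.9 (via `hK`)] -/
theorem stub_chromaticDivisibility_of_sharpFlatLowerDivisibility_rankZero
    (h22 : Sprung2012.thm22_exists_isHondaSystem)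
    (h52 : Sprung2024.sec52_sharpFlatSelmerDual_finite_torsion)
    (hK : Sprung2024.lem59_sharpFlatCharValue_rankZero) (hmod : hasEntireLFunction_rat)
    (hlift : ∀ (p : ℕ) [Fact p.Prime] (κ : ZpExtension ℚ p) (γ : Field.absoluteGaloisGroup ℚ),
      κ.IsCyclotomic → κ.IsTopGenerator γ →
      ∀ (v : HeightOneSpectrum (𝓞 ℚ)), (p : 𝓞 ℚ) ∈ v.asIdeal →
        ∃ g : Field.absoluteGaloisGroup (v.adicCompletion ℚ),
          κ.IsTopGenerator (resGalOfEmb (closureEmb (K := ℚ) (v.adicCompletion ℚ)) g))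
    (hdiv : ∀ (W : WeierstrassCurve ℚ) [W.IsElliptic] [W.IsGloballyMinimal] (p : ℕ) [Fact p.Prime],
      ClassX8 W p → ∀ (κ : ZpExtension ℚ p) (γ : Field.absoluteGaloisGroup ℚ),
        κ.IsCyclotomic → κ.IsTopGenerator γ → IsCyclotomicVariable p γ →
      ∀ (v : HeightOneSpectrum (𝓞 ℚ)), (p : 𝓞 ℚ) ∈ v.asIdeal →
      ∀ (g : Field.absoluteGaloisGroup (v.adicCompletion ℚ)),
        κ.IsTopGenerator (resGalOfEmb (closureEmb (K := ℚ) (v.adicCompletion ℚ)) g) →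
      ∀ (cneg : localPoints W (v.adicCompletion ℚ)) (c : ℕ → localPoints W (v.adicCompletion ℚ)),
        IsHondaSystem κ (closureEmb (K := ℚ) (v.adicCompletion ℚ)) W (W.frobeniusTrace p) g cneg c →
      ∀ (N : ℕ) (_ : NeZero N) (f : CuspForm (Gamma0 N) 2) (ϖ : ℚ) (Lsharp Lflat : IwasawaAlgebra p),
        IsNewformOf W f → (ϖ : ℝ) * W.realPeriodRat = plusPeriod f →
        IsSprungPair f p (W.frobeniusTrace p) Lsharp Lflat →
        ∃ col : Chroma,
          ∀ D : SharpFlatSelmerDualData W κ γ (closureEmb (K := ℚ) (v.adicCompletion ℚ))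
            (W.frobeniusTrace p) g c col,
          ∃ gen h : IwasawaAlgebra p, D.charIdeal = Ideal.span {gen} ∧
            iwasawaToPowerSeries p gen =
              PowerSeries.C (ϖ : ℚ_[p]) * iwasawaToPowerSeries p (chromaticL col Lsharp Lflat * h)) :
    ∀ (W : WeierstrassCurve ℚ) [W.IsElliptic] [W.IsGloballyMinimal] (p : ℕ) [Fact p.Prime],
      Literature.NumberTheory.EllipticCurves.Rank1Residual.ClassX8 W p → W.IsSemistable (𝓞 ℚ) →
      W.analyticRank = 0 →
      ∀ (N : ℕ) (_ : NeZero N) (f : CuspForm (CongruenceSubgroup.Gamma0 N) 2) (ϖ : ℚ)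
        (Lsharp Lflat : Literature.NumberTheory.EllipticCurves.IwasawaAlgebra p),
        Literature.NumberTheory.EllipticCurves.ModularForms.IsNewformOf W f →
        (ϖ : ℝ) * W.realPeriodRat = Literature.NumberTheory.EllipticCurves.ModularForms.plusPeriod f →
        Literature.NumberTheory.EllipticCurves.Sprung2017.IsSprungPair f p (W.frobeniusTrace p)
          Lsharp Lflat →
        ∃ (c : Literature.NumberTheory.EllipticCurves.Sprung2017.Chroma)
          (ξ : Literature.NumberTheory.EllipticCurves.IwasawaAlgebra p),
          (⟨ξ, 0, 0⟩ : Summit.BirchSwinnertonDyer.Rank1Residual.Supersingular.SignedDatum W p).EulerCharacteristic ∧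
          ∃ h : Literature.NumberTheory.EllipticCurves.IwasawaAlgebra p,
            Literature.NumberTheory.EllipticCurves.iwasawaToPowerSeries p ξ =
              PowerSeries.C (ϖ : ℚ_[p]) *
                Literature.NumberTheory.EllipticCurves.iwasawaToPowerSeries p
                  (Literature.NumberTheory.EllipticCurves.Sprung2017.chromaticL c Lsharp Lflat * h) := by
  intro W _ _ p _ hX hsst hr N hN f ϖ Lsharp Lflat hf hϖ hSP
  have hL : W.entireLFunction 1 ≠ 0 := (W.analyticRank_eq_zero_iff_holds (hmod W)).1 hr
  exact chromaticDivisibility_of_sharpFlatLowerDivisibility h22 h52 hK hlift hdiv W p hX hsst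
    (fun _ => hL) N hN f ϖ Lsharp Lflat hf hϖ hSP

end Real

end Summit.BirchSwinnertonDyer.BirchSwinnertonDyer.Theorems

end
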